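import Summits.AtomisticToContinuum.HydrodynamicLimit.Theorems.JParityClosureEvenStressEnskogClusterTransport
import Literature.MathematicalPhysics.StatisticalMechanics.LennardJonesClusters
import HarnessLib

/-!
# Microscale stationarity, I: sure bounds on the macroscopic terms of the cluster transport
# identity (helper file of `stub_microStationarity_of`, stub S2 of the line
# `stationary-microscale-hierarchy-entrance-law` of the crux `JParityClosure.EvenStressEnskog`,
# stmt-AtomisticToContinuum-13079)

Along a good orbit of `N + 1` hard spheres of diameter `ε = hsDiameter σ N` on `𝕋³` the cluster
transport identity (`stub_clusterTransport`, S1) reads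
`streamStat + collJump = ε (I(τ) − I(0)) − ε · wRateStat`, `I(s) = winInt … s z`.  This file
bounds the right-hand side SURELY on the hard-sphere domain in terms of the kinetic energy per
particle, uniformly in `N`:

* THE PACKING BOUND (`hardSphere_card_near_le`): in a hard-sphere configuration (pairwise minimal-image
  distances `≥ ε`) at most `(2R + 1)³` particles lie within minimal-image distance `εR` of a
  window centre — the minimal images `reprSym (x_k − x₀) ∈ ℝ³` are `ε`-separated (the symmetric
  representative is a shortest lift, `Torus.norm_reprSym_le_of_proj_eq`) in the Euclidean ball of
  radius `εR`, and the Euclidean packing lemma `card_le_of_separated_of_dist_le` applies;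
* hence the window observable of a compactly supported test function of level `m` (position
  support in `‖ξ_a‖ ≤ R`) is bounded by `((2R+1)³)^m · sup |P|` at EVERY centre, uniformly in `N`
  (`abs_winObs_le_of_mem_hardSphereDomain`), and so is the weighted window integral
  (`abs_winInt_le`);
* the free-streaming rate of the mollified density carries the weight `(N+1)⁻¹`:
  `|densRate| ≤ 3/(πr⁴) · (N+1)⁻¹ Σ_k ‖v_k‖ ≤ 3/(πr⁴) (1/2 + (N+1)⁻¹ E)` (`‖v‖ ≤ (1 + ‖v‖²)/2`,
  `abs_densRate_le_energy`), whence `|Ẇ| ≤ M_χ' M_g + M_χ M_g' σ³ 3/(πr⁴) (1/2 + K)` on the energy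
  shell `(N+1)⁻¹ E ≤ K` (`abs_weightRate_le_energy`) and, the energy being conserved along good
  orbits, `|wRateStat| ≤ τ (M_χ' M_g + M_χ M_g' σ³ 3/(πr⁴) (1/2 + K)) C_W` (`abs_wRateStat_le`);
* the assembled sure bound `|streamStat + collJump| ≤ ε · C(K)` (`abs_streamStat_add_collJump_le`).

References: H. Spohn, *Large Scale Dynamics of Interacting Particles* (1991), Part I §3.2 (the
`O(ε)` terms of the weak balance laws). Elementary. [folklore]
-/

noncomputable section

open MeasureTheory Set Filter Function Metric
open scoped BigOperators Topology InnerProductSpace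

namespace Summit.AtomisticToContinuum.HydrodynamicLimit.Theorems.EvenStressEnskog

open Literature.Analysis.FluidPDE Literature.Analysis.FunctionSpaces
  Literature.MathematicalPhysics.KineticTheory
  Literature.MathematicalPhysics.KineticTheory.StationaryMicroscale

/-! ## The packing bound on the flat torus -/

/-- **Packing bound in a hard-sphere configuration on `𝕋³`.** If the pairwise minimal-image
distances of `w` are `≥ ε > 0`, then for every centre `x₀` and `R ≥ 0` at most `(2R + 1)³`
particles lie within minimal-image distance `εR` of `x₀`: the minimal images
`reprSym (x_k − x₀) ∈ ℝ³` of these particles are `ε`-separated (a difference of two of them is a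
lift of `x_k − x_l`, and the symmetric representative is a shortest lift) and lie in the Euclidean
ball of radius `εR`, so the Euclidean packing lemma applies. [folklore] -/
theorem hardSphere_card_near_le :
    ∀ {N : ℕ} {ε : ℝ}, 0 < ε → ∀ {w : Config (N + 1) (Fin 3) T3},
      w ∈ hardSphereDomain (Torus.geometry (Fin 3)) (N + 1) ε → ∀ (x₀ : T3) {R : ℝ}, 0 ≤ R →
      (((Finset.univ.filter fun k : Fin (N + 1) => Torus.euclidDist (w k).1 x₀ ≤ ε * R).card : ℕ) : ℝ)
        ≤ (2 * R + 1) ^ 3 := by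
  intro N ε hε w hw x₀ R hR
  classical
  set S : Finset (Fin (N + 1)) :=
    Finset.univ.filter fun k : Fin (N + 1) => Torus.euclidDist (w k).1 x₀ ≤ ε * R with hS
  set f : Fin (N + 1) → V3 := fun k => Torus.reprSym ((w k).1 - x₀) with hf
  have hsep : ∀ k l : Fin (N + 1), k ≠ l → ε ≤ ‖f k - f l‖ := by
    intro k l hkl
    have h1 : ε ≤ ‖(Torus.geometry (Fin 3)).sepVec (w k).1 (w l).1‖ :=
      (mem_hardSphereDomain.1 hw) k l hkl
    rw [Torus.geometry_sepVec] at h1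
    refine h1.trans (Torus.norm_reprSym_le_of_proj_eq ?_)
    rw [hf, sub_eq_add_neg, Torus.proj_add, Torus.proj_neg, Torus.proj_reprSym, Torus.proj_reprSym]
    abel
  have hinj : Set.InjOn f (S : Set (Fin (N + 1))) := by
    intro k _ l _ hkl
    by_contra hne
    have h := hsep k l hne
    rw [hkl, sub_self, norm_zero] at h
    exact (not_le.2 hε) h
  have hcard : S.card = (S.image f).card := (Finset.card_image_of_injOn hinj).symm
  rw [hcard]
  have key := Literature.MathematicalPhysics.StatisticalMechanics.card_le_of_separated_of_dist_le
    (S.image f) (0 : V3) hε (mul_nonneg hε.le hR) ?_ ?_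
  · rw [finrank_euclideanSpace_fin] at key
    have hq : 2 * (ε * R) / ε + 1 = 2 * R + 1 := by
      field_simp
    rwa [hq] at key
  · intro c hc
    obtain ⟨k, hk, rfl⟩ := Finset.mem_image.1 hc
    rw [dist_zero_right]
    exact (Finset.mem_filter.1 hk).2
  · intro c hc d hd hcd
    obtain ⟨k, _, rfl⟩ := Finset.mem_image.1 hc
    obtain ⟨l, _, rfl⟩ := Finset.mem_image.1 hd
    rw [dist_eq_norm]
    exact hsep k l fun h => hcd (by rw [h])

/-! ## The window observable on the hard-sphere domain -/

/-- The closed support of a compactly supported tuple test function has bounded positions: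
`‖ξ_a‖ ≤ R` on `tsupport P` for some `R ≥ 0`. [folklore] -/
theorem exists_radius_of_hasCompactSupport {m : ℕ} {P : (Fin m → V3 × V3) → ℝ}
    (hPc : HasCompactSupport P) : ∃ R : ℝ, 0 ≤ R ∧ ∀ q ∈ tsupport P, ∀ a, ‖(q a).1‖ ≤ R := by
  obtain ⟨R, hR⟩ := hPc.isCompact.isBounded.subset_closedBall 0
  refine ⟨max R 0, le_max_right _ _, fun q hq a => ?_⟩
  have h1 : ‖q‖ ≤ R := mem_closedBall_zero_iff.1 (hR hq)
  exact ((norm_fst_le (q a)).trans ((norm_le_pi_norm q a).trans h1)).trans (le_max_left _ _)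

/-- **The window observable is bounded on the hard-sphere domain, uniformly in `N`**: if
`|P| ≤ M_P` and the positions of `tsupport P` lie in `‖ξ_a‖ ≤ R`, then for every hard-sphere
configuration `w` (pairwise distances `≥ ε`) and every centre,
`|winObs ε P w x₀| ≤ ((2R + 1)³)^m M_P` — a tuple contributes only if all its particles are within
`εR` of the centre, there are at most `(2R+1)³` such particles (`hardSphere_card_near_le`), hence at most
`((2R+1)³)^m` such tuples. [folklore] -/
theorem abs_winObs_le_of_mem_hardSphereDomain {N m : ℕ} {ε : ℝ} (hε : 0 < ε)
    {P : (Fin m → V3 × V3) → ℝ} {MP R : ℝ} (hMP : ∀ q, |P q| ≤ MP) (hR0 : 0 ≤ R)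
    (hR : ∀ q ∈ tsupport P, ∀ a, ‖(q a).1‖ ≤ R) {w : Config (N + 1) (Fin 3) T3}
    (hw : w ∈ hardSphereDomain (Torus.geometry (Fin 3)) (N + 1) ε) (x₀ : T3) :
    |winObs ε P w x₀| ≤ ((2 * R + 1) ^ 3) ^ m * MP := by
  classical
  have hMP0 : 0 ≤ MP := (abs_nonneg _).trans (hMP 0)
  set S : Finset (Fin (N + 1)) :=
    Finset.univ.filter fun k : Fin (N + 1) => Torus.euclidDist (w k).1 x₀ ≤ ε * R with hS
  set F : Finset (Fin m ↪ Fin (N + 1)) := Finset.univ.filter fun ι => ∀ a, ι a ∈ S with hF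
  have hzero : ∀ ι : Fin m ↪ Fin (N + 1), ι ∉ F → P (tupleData ε w x₀ ι) = 0 := by
    intro ι hι
    simp only [hF, Finset.mem_filter, Finset.mem_univ, true_and, not_forall] at hι
    obtain ⟨a, ha⟩ := hι
    simp only [hS, Finset.mem_filter, Finset.mem_univ, true_and, not_le] at ha
    refine image_eq_zero_of_notMem_tsupport fun hmem => ?_
    have h := hR _ hmem a
    simp only [tupleData, norm_smul, norm_inv, Real.norm_eq_abs, abs_of_pos hε,
      Torus.norm_geometry_sepVec] at h
    rw [inv_mul_le_iff₀ hε] at h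
    exact (not_lt.2 h) ha
  have hsum : winObs ε P w x₀ = ∑ ι ∈ F, P (tupleData ε w x₀ ι) := by
    unfold winObs
    exact (Finset.sum_subset (Finset.filter_subset _ _) fun ι _ hι => hzero ι hι).symm
  have hcardS : (S.card : ℝ) ≤ (2 * R + 1) ^ 3 := hardSphere_card_near_le hε hw x₀ hR0
  have hcardF : F.card ≤ S.card ^ m := by
    have h := Finset.card_le_card_of_injOn (s := F) (t := Fintype.piFinset fun _ : Fin m => S)
      (fun ι : Fin m ↪ Fin (N + 1) => (ι : Fin m → Fin (N + 1))) ?_ ?_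
    · rwa [Fintype.card_piFinset_const] at h
    · intro ι hι
      rw [Finset.mem_coe, Fintype.mem_piFinset]
      exact (Finset.mem_filter.1 hι).2
    · exact fun ι _ ι' _ h => DFunLike.coe_injective h
  calc |winObs ε P w x₀| = |∑ ι ∈ F, P (tupleData ε w x₀ ι)| := by rw [hsum]
    _ ≤ ∑ ι ∈ F, |P (tupleData ε w x₀ ι)| := Finset.abs_sum_le_sum_abs _ _
    _ ≤ ∑ _ι ∈ F, MP := Finset.sum_le_sum fun ι _ => hMP _
    _ = F.card * MP := by rw [Finset.sum_const, nsmul_eq_mul]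
    _ ≤ (S.card : ℝ) ^ m * MP := by
        gcongr
        exact_mod_cast hcardF
    _ ≤ ((2 * R + 1) ^ 3) ^ m * MP := by
        gcongr

/-! ## The free-streaming rates on an energy shell -/

/-- **Sharp bound on the free-streaming rate of the mollified density**: `densRate` carries the
weight `(N+1)⁻¹`, and `(N+1)⁻¹ Σ_k ‖v_k‖ ≤ 1/2 + (N+1)⁻¹ E` (`‖v‖ ≤ (1 + ‖v‖²)/2`), so
`|densRate r w x₀| ≤ 3/(πr⁴) (1/2 + (N+1)⁻¹ E(w))`. [folklore] -/
theorem abs_densRate_le_energy {N : ℕ} {r : ℝ} (hr : 0 < r) (w : Config (N + 1) (Fin 3) T3)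
    (x₀ : T3) :
    |densRate r w x₀| ≤ 3 / (Real.pi * r ^ 4) * (1 / 2 + ((N : ℝ) + 1)⁻¹ * configEnergy w) := by
  unfold densRate
  have hC : 0 ≤ 3 / (Real.pi * r ^ 4) := by positivity
  have hk : ∀ k : Fin (N + 1),
      |(if 0 < Torus.euclidDist (w k).1 x₀ ∧ Torus.euclidDist (w k).1 x₀ < r then
          -(3 / (Real.pi * r ^ 4)) * ⟪(Torus.geometry (Fin 3)).sepVec (w k).1 x₀, (w k).2⟫_ℝ /
            Torus.euclidDist (w k).1 x₀ else 0)| ≤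
        3 / (Real.pi * r ^ 4) * ((1 + ‖(w k).2‖ ^ 2) / 2) := by
    intro k
    have hAM : ‖(w k).2‖ ≤ (1 + ‖(w k).2‖ ^ 2) / 2 := by
      nlinarith [sq_nonneg (‖(w k).2‖ - 1)]
    split_ifs with h
    · rw [abs_div, abs_mul, abs_neg, abs_of_nonneg hC, abs_of_pos h.1, mul_div_assoc]
      refine mul_le_mul_of_nonneg_left (le_trans ?_ hAM) hC
      rw [div_le_iff₀ h.1, ← Torus.norm_geometry_sepVec, mul_comm]
      exact abs_real_inner_le_norm _ _
    · rw [abs_zero]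
      positivity
  have hN0 : (0 : ℝ) < (N : ℝ) + 1 := by positivity
  have hsum : ∑ k : Fin (N + 1), 3 / (Real.pi * r ^ 4) * ((1 + ‖(w k).2‖ ^ 2) / 2) =
      3 / (Real.pi * r ^ 4) * (((N : ℝ) + 1) / 2 + configEnergy w) := by
    rw [← Finset.mul_sum]
    congr 1
    have h1 : ∑ k : Fin (N + 1), (1 + ‖(w k).2‖ ^ 2) / 2 =
        ∑ _k : Fin (N + 1), (1 / 2 : ℝ) + 2⁻¹ * ∑ k : Fin (N + 1), ‖(w k).2‖ ^ 2 := by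
      rw [Finset.mul_sum, ← Finset.sum_add_distrib]
      exact Finset.sum_congr rfl fun k _ => by ring
    rw [h1, Finset.sum_const, Finset.card_univ, Fintype.card_fin, nsmul_eq_mul, configEnergy]
    push_cast
    ring
  rw [abs_mul, abs_of_nonneg (inv_nonneg.2 hN0.le)]
  calc ((N : ℝ) + 1)⁻¹ * |∑ k : Fin (N + 1), _|
      ≤ ((N : ℝ) + 1)⁻¹ *
          ∑ k : Fin (N + 1), 3 / (Real.pi * r ^ 4) * ((1 + ‖(w k).2‖ ^ 2) / 2) :=
        mul_le_mul_of_nonneg_left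
          ((Finset.abs_sum_le_sum_abs _ _).trans (Finset.sum_le_sum fun k _ => hk k))
          (inv_nonneg.2 hN0.le)
    _ = 3 / (Real.pi * r ^ 4) * (1 / 2 + ((N : ℝ) + 1)⁻¹ * configEnergy w) := by
        rw [hsum]
        field_simp

/-- **Bound on the free-streaming rate of the weight on an energy shell**: with sup bounds
`M_χ, M_χ'` of `χ, ∂ₛχ` on a time set, GLOBAL bounds `M_g, M_g'` of `g, g′` and
`(N+1)⁻¹ E(z) ≤ K`, `|Ẇ| ≤ M_χ' M_g + M_χ M_g' σ³ · 3/(πr⁴) (1/2 + K)`. [folklore] -/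
theorem abs_weightRate_le_energy {N : ℕ} {σ : ℝ} (hσ : 0 ≤ σ) {χ : ℝ × T3 → ℝ} {g : ℝ → ℝ}
    {r : ℝ} (hr : 0 < r) {S : Set ℝ} {Mχ Mχ' Mg Mg' K : ℝ}
    (hχM : ∀ s ∈ S, ∀ x : T3, |χ (s, x)| ≤ Mχ)
    (hχM' : ∀ s ∈ S, ∀ x : T3, |deriv (fun s' => χ (s', x)) s| ≤ Mχ')
    (hgM : ∀ y, |g y| ≤ Mg) (hgM' : ∀ y, |deriv g y| ≤ Mg') {s : ℝ} (hs : s ∈ S)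
    {z : Config (N + 1) (Fin 3) T3} (hE : ((N : ℝ) + 1)⁻¹ * configEnergy z ≤ K) (x₀ : T3) :
    |weightRate σ χ g r s z x₀| ≤
      Mχ' * Mg + Mχ * Mg' * (σ ^ 3 * (3 / (Real.pi * r ^ 4) * (1 / 2 + K))) := by
  unfold weightRate
  have hMχ : 0 ≤ Mχ := (abs_nonneg _).trans (hχM s hs x₀)
  have hMg' : 0 ≤ Mg' := (abs_nonneg _).trans (hgM' 0)
  have hC : 0 ≤ 3 / (Real.pi * r ^ 4) := by positivity
  have hdens : |densRate r z x₀| ≤ 3 / (Real.pi * r ^ 4) * (1 / 2 + K) :=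
    (abs_densRate_le_energy hr z x₀).trans (mul_le_mul_of_nonneg_left (by linarith) hC)
  refine (abs_add_le (_ : ℝ) _).trans (add_le_add ?_ ?_)
  · rw [abs_mul]
    exact mul_le_mul (hχM' s hs x₀) (hgM _) (abs_nonneg _) ((abs_nonneg _).trans (hχM' s hs x₀))
  · rw [abs_mul, abs_mul, abs_mul, abs_of_nonneg (pow_nonneg hσ 3)]
    refine mul_le_mul (mul_le_mul (hχM s hs x₀) (hgM' _) (abs_nonneg _) hMχ) ?_
      (by positivity) (mul_nonneg hMχ hMg')
    exact mul_le_mul_of_nonneg_left hdens (pow_nonneg hσ 3)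

/-! ## The macroscopic functionals along a good orbit -/

/-- The flat `3`-torus has total Haar mass one. [folklore] -/
theorem volume_real_univ_torus3 : (volume : Measure T3).real univ = 1 := by
  have h : (volume : Measure T3) univ = 1 := by
    rw [volume_pi, Measure.pi_univ]
    simp
  simp [Measure.real, h]

section Orbit

variable {σ : ℝ} {N m : ℕ} {χ : ℝ × T3 → ℝ} {g : ℝ → ℝ} {r : ℝ} {P : (Fin m → V3 × V3) → ℝ}
  {Mχ Mχ' Mg Mg' CW K : ℝ}

/-- **Bound on the weighted window integral**: at a time `s` of the time set carrying the sup
bound of `χ`, if `Φ_s z` is a hard-sphere configuration and `|winObs| ≤ C_W` on the hard-sphere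
domain, then `|I(s)| ≤ M_χ M_g C_W` (the torus has volume one). [folklore] -/
theorem abs_winInt_le (hσ : 0 ≤ σ) (Φ : HardSphereFlow (Torus.geometry (Fin 3)) (hsDiameter σ N) (N + 1))
    (hr : 0 < r) {S : Set ℝ} (hχM : ∀ s ∈ S, ∀ x : T3, |χ (s, x)| ≤ Mχ) (hgM : ∀ y, |g y| ≤ Mg)
    (hW : ∀ w ∈ hardSphereDomain (Torus.geometry (Fin 3)) (N + 1) (hsDiameter σ N), ∀ x₀,
      |winObs (hsDiameter σ N) P w x₀| ≤ CW)
    {s : ℝ} (hs : s ∈ S) {z : Config (N + 1) (Fin 3) T3}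
    (hz : Φ.flow s z ∈ hardSphereDomain (Torus.geometry (Fin 3)) (N + 1) (hsDiameter σ N)) :
    |winInt σ N Φ χ g r P s z| ≤ Mχ * Mg * CW := by
  unfold winInt
  have huniv : (volume : Measure T3) univ = 1 := by
    rw [volume_pi, Measure.pi_univ]
    simp
  haveI : IsProbabilityMeasure (volume : Measure T3) := ⟨huniv⟩
  have h := norm_integral_le_of_norm_le_const (μ := (volume : Measure T3)) (C := Mχ * Mg * CW)
    (f := fun x₀ => weight σ χ g r s (Φ.flow s z) x₀ * winObs (hsDiameter σ N) P (Φ.flow s z) x₀)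
    (ae_of_all _ fun x₀ => ?_)
  · rwa [volume_real_univ_torus3, mul_one, Real.norm_eq_abs] at h
  · rw [Real.norm_eq_abs, abs_mul]
    have h1 := abs_weight_le (σ := σ) hσ hr hχM (fun y _ => hgM y) hs (Φ.flow s z) x₀
    exact mul_le_mul h1 (hW _ hz x₀) (abs_nonneg _) ((abs_nonneg _).trans h1)

/-- **Bound on the weight-rate functional along a good orbit**: with sup bounds of `χ, ∂ₛχ` on
`[0, τ]`, global bounds of `g, g′`, `|winObs| ≤ C_W` on the hard-sphere domain and
`(N+1)⁻¹ E(z) ≤ K`, `|wRateStat| ≤ τ (M_χ' M_g + M_χ M_g' σ³ 3/(πr⁴) (1/2 + K)) C_W` — the orbit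
stays in the good set (`mapsTo_good`, `good_subset`) and the kinetic energy is conserved
(`HardSphereFlow.configEnergy_flow`). [folklore] -/
theorem abs_wRateStat_le (hσ : 0 ≤ σ)
    (Φ : HardSphereFlow (Torus.geometry (Fin 3)) (hsDiameter σ N) (N + 1)) {τ : ℝ} (hτ : 0 ≤ τ)
    (hr : 0 < r) (hχM : ∀ s ∈ Icc (0 : ℝ) τ, ∀ x : T3, |χ (s, x)| ≤ Mχ)
    (hχM' : ∀ s ∈ Icc (0 : ℝ) τ, ∀ x : T3, |deriv (fun s' => χ (s', x)) s| ≤ Mχ')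
    (hgM : ∀ y, |g y| ≤ Mg) (hgM' : ∀ y, |deriv g y| ≤ Mg')
    (hW : ∀ w ∈ hardSphereDomain (Torus.geometry (Fin 3)) (N + 1) (hsDiameter σ N), ∀ x₀,
      |winObs (hsDiameter σ N) P w x₀| ≤ CW)
    {z : Config (N + 1) (Fin 3) T3} (hz : z ∈ Φ.good) (hE : ((N : ℝ) + 1)⁻¹ * configEnergy z ≤ K) :
    |wRateStat σ N Φ τ χ g r P z| ≤
      τ * ((Mχ' * Mg + Mχ * Mg' * (σ ^ 3 * (3 / (Real.pi * r ^ 4) * (1 / 2 + K)))) * CW) := by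
  unfold wRateStat
  have huniv : (volume : Measure T3) univ = 1 := by
    rw [volume_pi, Measure.pi_univ]
    simp
  haveI : IsProbabilityMeasure (volume : Measure T3) := ⟨huniv⟩
  set A : ℝ := (Mχ' * Mg + Mχ * Mg' * (σ ^ 3 * (3 / (Real.pi * r ^ 4) * (1 / 2 + K)))) * CW
    with hA
  have hinner : ∀ s ∈ Icc (0 : ℝ) τ,
      ‖∫ x₀ : T3, weightRate σ χ g r s (Φ.flow s z) x₀ *
          winObs (hsDiameter σ N) P (Φ.flow s z) x₀‖ ≤ A := by
    intro s hs
    have hzs : Φ.flow s z ∈ Φ.good := Φ.mapsTo_good s hz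
    have hdom := Φ.good_subset hzs
    have hEs : ((N : ℝ) + 1)⁻¹ * configEnergy (Φ.flow s z) ≤ K := by
      rwa [Φ.configEnergy_flow hz s]
    have h := norm_integral_le_of_norm_le_const (μ := (volume : Measure T3)) (C := A)
      (f := fun x₀ => weightRate σ χ g r s (Φ.flow s z) x₀ *
        winObs (hsDiameter σ N) P (Φ.flow s z) x₀)
      (ae_of_all _ fun x₀ => ?_)
    · rwa [volume_real_univ_torus3, mul_one] at h
    · rw [Real.norm_eq_abs, abs_mul, hA]
      have h1 := abs_weightRate_le_energy (σ := σ) hσ hr hχM hχM' hgM hgM' hs hEs x₀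
      exact mul_le_mul h1 (hW _ hdom x₀) (abs_nonneg _) ((abs_nonneg _).trans h1)
  have h := norm_setIntegral_le_of_norm_le_const (μ := (volume : Measure ℝ)) (s := Icc (0 : ℝ) τ)
    measure_Icc_lt_top hinner
  rw [Real.volume_real_Icc_of_le hτ, sub_zero, Real.norm_eq_abs] at h
  rw [mul_comm]
  exact h

/-- **The sure bound.** Along a good orbit with `(N+1)⁻¹ E(z) ≤ K`, if the cluster transport
identity holds, then
`|streamStat + collJump| ≤ ε (2 M_χ M_g C_W + τ (M_χ' M_g + M_χ M_g' σ³ 3/(πr⁴) (1/2 + K)) C_W)`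
(`streamStat + collJump = ε (I(τ) − I(0)) − ε wRateStat`, `abs_winInt_le`, `abs_wRateStat_le`).
[folklore] -/
theorem abs_streamStat_add_collJump_le (hσ : 0 < σ)
    (Φ : HardSphereFlow (Torus.geometry (Fin 3)) (hsDiameter σ N) (N + 1)) {τ : ℝ} (hτ : 0 ≤ τ)
    (hr : 0 < r) (hχM : ∀ s ∈ Icc (0 : ℝ) τ, ∀ x : T3, |χ (s, x)| ≤ Mχ)
    (hχM' : ∀ s ∈ Icc (0 : ℝ) τ, ∀ x : T3, |deriv (fun s' => χ (s', x)) s| ≤ Mχ')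
    (hgM : ∀ y, |g y| ≤ Mg) (hgM' : ∀ y, |deriv g y| ≤ Mg')
    (hW : ∀ w ∈ hardSphereDomain (Torus.geometry (Fin 3)) (N + 1) (hsDiameter σ N), ∀ x₀,
      |winObs (hsDiameter σ N) P w x₀| ≤ CW)
    {z : Config (N + 1) (Fin 3) T3} (hz : z ∈ Φ.good) (hE : ((N : ℝ) + 1)⁻¹ * configEnergy z ≤ K)
    (hid : hsDiameter σ N * (winInt σ N Φ χ g r P τ z - winInt σ N Φ χ g r P 0 z)
        - hsDiameter σ N * wRateStat σ N Φ τ χ g r P z - streamStat σ N Φ τ χ g r P z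
        = collJump σ N Φ τ χ g r P z) :
    |streamStat σ N Φ τ χ g r P z + collJump σ N Φ τ χ g r P z| ≤
      hsDiameter σ N * (2 * (Mχ * Mg * CW) +
        τ * ((Mχ' * Mg + Mχ * Mg' * (σ ^ 3 * (3 / (Real.pi * r ^ 4) * (1 / 2 + K)))) * CW)) := by
  have hε : 0 < hsDiameter σ N := hsDiameter_pos hσ N
  have hIτ := abs_winInt_le hσ.le Φ hr hχM hgM hW (right_mem_Icc.2 hτ)
    (Φ.good_subset (Φ.mapsTo_good τ hz))
  have hI0 := abs_winInt_le hσ.le Φ hr hχM hgM hW (left_mem_Icc.2 hτ)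
    (Φ.good_subset (Φ.mapsTo_good 0 hz))
  have hWR := abs_wRateStat_le hσ.le Φ hτ hr hχM hχM' hgM hgM' hW hz hE
  have heq : streamStat σ N Φ τ χ g r P z + collJump σ N Φ τ χ g r P z =
      hsDiameter σ N * (winInt σ N Φ χ g r P τ z - winInt σ N Φ χ g r P 0 z) -
        hsDiameter σ N * wRateStat σ N Φ τ χ g r P z := by
    linear_combination hid.symm
  rw [heq]
  set Iτ := winInt σ N Φ χ g r P τ z
  set I0 := winInt σ N Φ χ g r P 0 z
  set W := wRateStat σ N Φ τ χ g r P z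
  calc |hsDiameter σ N * (Iτ - I0) - hsDiameter σ N * W|
      ≤ |hsDiameter σ N * (Iτ - I0)| + |hsDiameter σ N * W| := abs_sub _ _
    _ = hsDiameter σ N * |Iτ - I0| + hsDiameter σ N * |W| := by
        rw [abs_mul, abs_mul, abs_of_pos hε]
    _ ≤ hsDiameter σ N * (|Iτ| + |I0|) + hsDiameter σ N * |W| := by
        gcongr
        exact abs_sub _ _
    _ ≤ hsDiameter σ N * (Mχ * Mg * CW + Mχ * Mg * CW) + hsDiameter σ N *
          (τ * ((Mχ' * Mg + Mχ * Mg' * (σ ^ 3 * (3 / (Real.pi * r ^ 4) * (1 / 2 + K)))) * CW)) := by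
        gcongr
    _ = hsDiameter σ N * (2 * (Mχ * Mg * CW) +
          τ * ((Mχ' * Mg + Mχ * Mg' * (σ ^ 3 * (3 / (Real.pi * r ^ 4) * (1 / 2 + K)))) * CW)) := by
        ring

end Orbit

end Summit.AtomisticToContinuum.HydrodynamicLimit.Theorems.EvenStressEnskog

end
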